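import Summits.Parity.GeneralizedHardyLittlewood.Theorems.BeyondDiagonalBeatsQuarter.OffDiagLevelFactorUnitBox
import Summits.Parity.GeneralizedHardyLittlewood.Theorems.BeyondDiagonalBeatsQuarter.OffDiagCoreKernels
import HarnessLib

/-!
# Route `PrimeLevelFamEdge`, crux K_B (stmt-Parity-20343), line `diagonal_kernel_split` rev 4, plan Ω,
# node **L7d part 2, leaf S₄ — a `levelLargePart` against the box transform is a UNIT-BOX integral of
# `levelLargePart`s against the level factor** (L7D-PLAN rev 5 §5 (2); consumer of prover-8's
# `sum_mul_fourier2_boxWeight_cell_eq_unitBox`)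

After S₃ (`levelLargePart_window_eq_separated`) a member of the windowed FL-family enters through
`levelLargePart R Q (q ↦ g(q)·Φ̂_{q,x}(h₁/(q(r+1)), s/h₁ + ab/(h₁q(r+1)))) n_x a_x` with a level weight `g` free of the
member. Writing `levelLargePart R Q F n a = Σ_{q∈Q} κ_q·F q` with the kernel `κ_q = levelLargePart R {q} 1 n a`
(`sum_levelLargePart_singleton_mul`) and applying prover-8's unit-box form of the switched cell to the finite level sum
with weights `κ_q·g(q)` gives, with NO interchange of character sums and integrals,

  `levelLargePart R Q (g·Φ̂_{·,x}) n a = (K₁K₂) • ∫dτ₁∫dτ₂ Kern_x(τ) · levelLargePart R Q (q ↦ g(q)·Ψ_τ(x; 1/q)) n a`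

(**`levelLargePart_boxTransform_eq_unitBox`**), `Kern_x(τ) = θ(τ₁)θ(τ₂)(d₁K₁τ₁d₂K₂τ₂)^{−1/2}(r+1)⁻¹·e(−K₂τ₂·s/h₁)`,
`Ψ_τ(x; v) = W(a_x(τ)v)·J₁(b_x(τ)v)·e(−κ_x(τ)v)` — the Taylor separation of `Ψ_τ` in `v = 1/q`
(`levelFactor_separation_box`) then acts inside the integrand, pointwise in `τ` (next leaf).

Exact identity; standard axioms. Helper toward `stub_offDiagBelowSlack_io`; closes nothing.
«The programme SEARCHES and TYPES; no claim about Landau–Siegel zeros, Theorems 1–2 of arXiv:2211.02515 or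
a repaired Margin232 until a kernel theorem says so.»
-/

noncomputable section

open Finset Real Complex MeasureTheory
open scoped Nat

namespace Summit.Parity.GeneralizedHardyLittlewood.Theorems.BeyondDiagonalBeatsQuarter.OffDiag

open Literature.Analysis.FunctionSpaces (besselJ)
open Literature.Analysis.Calculus.WhitneyConvex (dyadicBump)
open Literature.NumberTheory.LFunctions.KMV2000 (cutoffW)
open Literature.NumberTheory.Sieve.FriedlanderIwaniecPrimes (fourier2 ker)
open LevelSeparation (sum_mul_fourier2_boxWeight_cell_eq_unitBox)

/-- **A `levelLargePart` against the box transform as a unit-box integral of `levelLargePart`s against the level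
factor.** For levels `q ≠ 0` on `Q`, `l, m ≥ 1`, `d₁ ∣ l`, `d₂ ∣ m`, any `g : ℕ → ℂ`, `R`, class `a mod n`:
`levelLargePart R Q (q ↦ g q·Φ̂_{q,…}(h₁/(q(r+1)), s/h₁ + ab/(h₁q(r+1)))) n a
   = (K₁K₂) • ∫dτ₁∫dτ₂ Kern(τ)·levelLargePart R Q (q ↦ g q·Ψ_τ(1/q)) n a`.
[cite: KowalskiMichelVanderKam2000, §6 p. 19, (21)–(23) p. 12 — derivation] -/
theorem levelLargePart_boxTransform_eq_unitBox (R : ℕ) (Q : Finset ℕ) (hQ : ∀ q ∈ Q, q ≠ 0) {l m d₁ d₂ : ℕ}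
    (hl : 1 ≤ l) (hm : 1 ≤ m) (hd₁ : d₁ ∣ l) (hd₂ : d₂ ∣ m) (r : ℕ) (i : ℕ × ℕ) (h₁ s : ℤ) (g : ℕ → ℂ)
    {n : ℕ} (a : ZMod n) :
    levelLargePart R Q (fun q ↦ g q *
        fourier2 (boxWeight q d₁ d₂ (l / d₁) (m / d₂) (r + 1) i) ((h₁ : ℝ) / ((q * (r + 1) : ℕ) : ℝ))
          ((s : ℝ) / h₁ + (((l / d₁ : ℕ) : ℤ) * (m / d₂ : ℕ) : ℝ) / ((h₁ : ℝ) * ((q * (r + 1) : ℕ) : ℝ)))) n a =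
      ((2 : ℝ) ^ i.1 * 2 ^ i.2 : ℝ) •
        ∫ τ₁, ∫ τ₂, (((dyadicBump τ₁ * dyadicBump τ₂ *
            (((d₁ : ℝ) * (2 ^ i.1 * τ₁) * ((d₂ : ℝ) * (2 ^ i.2 * τ₂))) ^ (-(1 / 2 : ℝ)) * (((r + 1 : ℕ) : ℝ))⁻¹) : ℝ) : ℂ) *
              ker (2 ^ i.2 * τ₂) ((s : ℝ) / h₁)) *
          levelLargePart R Q (fun q ↦ g q *
            (((cutoffW ((4 * π ^ 2 * ((d₁ : ℝ) * (2 ^ i.1 * τ₁) * ((d₂ : ℝ) * (2 ^ i.2 * τ₂)))) * ((q : ℝ))⁻¹) : ℝ) : ℂ) *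
              ((besselJ 1 ((4 * π * Real.sqrt (((l / d₁ : ℕ) : ℝ) * (2 ^ i.1 * τ₁) * (((m / d₂ : ℕ) : ℝ) * (2 ^ i.2 * τ₂))) /
                  ((r + 1 : ℕ) : ℝ)) * ((q : ℝ))⁻¹) : ℝ) : ℂ) *
                Complex.exp (((-2 * π * ((2 ^ i.1 * τ₁) * ((h₁ : ℝ) / (r + 1)) +
                    (2 ^ i.2 * τ₂) * ((((l / d₁ : ℕ) : ℤ) * (m / d₂ : ℕ) : ℝ) / ((h₁ : ℝ) * (r + 1)))) *
                  ((q : ℝ))⁻¹ : ℝ) : ℂ) * I))) n a := by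
  classical
  -- the singleton-kernel form of the left side, then the unit-box identity with weights `κ_q·g q`
  rw [← sum_levelLargePart_singleton_mul Q _ n R a]
  have h1 : ∑ q ∈ Q, levelLargePart R {q} (fun _ ↦ (1 : ℂ)) n a * (g q *
      fourier2 (boxWeight q d₁ d₂ (l / d₁) (m / d₂) (r + 1) i) ((h₁ : ℝ) / ((q * (r + 1) : ℕ) : ℝ))
        ((s : ℝ) / h₁ + (((l / d₁ : ℕ) : ℤ) * (m / d₂ : ℕ) : ℝ) / ((h₁ : ℝ) * ((q * (r + 1) : ℕ) : ℝ)))) =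
      ∑ q ∈ Q, (levelLargePart R {q} (fun _ ↦ (1 : ℂ)) n a * g q) *
      fourier2 (boxWeight q d₁ d₂ (l / d₁) (m / d₂) (r + 1) i) ((h₁ : ℝ) / ((q * (r + 1) : ℕ) : ℝ))
        ((s : ℝ) / h₁ + (((l / d₁ : ℕ) : ℤ) * (m / d₂ : ℕ) : ℝ) / ((h₁ : ℝ) * ((q * (r + 1) : ℕ) : ℝ))) :=
    Finset.sum_congr rfl fun q _ ↦ by ring
  rw [h1, sum_mul_fourier2_boxWeight_cell_eq_unitBox hl hm hd₁ hd₂ r i h₁ s _ Q hQ]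
  congr 1
  refine integral_congr_ae (Filter.Eventually.of_forall fun τ₁ ↦ ?_)
  refine integral_congr_ae (Filter.Eventually.of_forall fun τ₂ ↦ ?_)
  dsimp only
  congr 1
  rw [← sum_levelLargePart_singleton_mul Q _ n R a]
  exact Finset.sum_congr rfl fun q _ ↦ by ring

end Summit.Parity.GeneralizedHardyLittlewood.Theorems.BeyondDiagonalBeatsQuarter.OffDiag
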